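import Summits.ResolutionOfSingularities.ResolutionOfSingularities.Theorems.PurelyInseparableDim4Perm2BoundWitness
import Summits.ResolutionOfSingularities.ResolutionOfSingularities.Theorems.PurelyInseparableDim4MohAlongBound
import HarnessLib

/-!
# [OURS · res-dim4-pi PR-2, part 9] The PERM2-0 laws at points MOVING ALONG the centre: transport by
  the PR-1 dictionary (move to `c`, re-clean, then a point over the origin)

Cell `res-dim4-pi` (D-0157 DOOR 2), lineage **PR-2** (seat `res-dim4-p-2`, generation 3), part 9 (sequel of parts
3 `…Perm2BoundTranslated` p648595, 6a `…Perm2BoundAttained` p672725, 7 `…Perm2BoundWitness` p673248, and of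
brick PR-1's `…MohAlong` / `…MohAlongBound` (seat `res-dim4-p-1`), whose transport lemmas are used BY NAME and
not restated). Parts 2–8 bound the edge of a coordinate centre `V(z, x_S)` (condition (1) only, chart `j ∈ S`) at
points `b` OVER THE ORIGIN of the centre (`b = 0` off `S`). A general chart point is `b = b′ + c` with `b′`
supported on `S ∖ j` and `c` supported OFF `S` (a point moving along the centre); PR-1's
`MohAlong.step_add_eq_step_translate_clean` rewrites the step as the step at `b′` of the state MOVED to `c`:
`s@c := (clean(F(x + c)), r|_{c = 0}, exc|_{c = 0})`, and PR-1's transport lemmas say that `s@c` is again clean,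
non-zero, divisible by its exceptional monomial and satisfies condition (1) for the same `S`. Hence every
PERM2-0 law of parts 3/6a/7 holds at EVERY chart point, in the letters `(d_c, r_c, g_c)` of the moved state:

* §1 (`q = p^e`, `e ≥ 1`, any finite index type): **`shade_step_add_le_two_mul_add_pow_along` :
  `d′ + ordAlong S F_c ≤ 2 d_c + degIn S r_c + p^{e−1}`** (part 3 transported);
* §2 (`q = p`): **`shade_step_add_eq_two_mul_add_one_iff_along`** — maximal excess relative to `s@c` ⟺ the edge
  `(s@c, b′)` is tight ∧ its point blow-up is a kangaroo (part 6a transported); and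
  **`shade_step_step_add_le_two_mul_along`** — after such an edge the next edge over the origin of ANY
  condition-(1) centre of the new state has no excess (part 7 transported: the new state IS `step p S j b′ (s@c)`);
* §3 the class `(4,1)` with an arbitrary chart point `b` (`b_j = 0`), `c = S.piecewise 0 b`, `b′ = S.piecewise b 0`
  (PR-1's `MohAlong.piecewise_add_piecewise`): `shade_add_ordAlong_le_add_pow_of_edge_point`.

## What is NOT proved (honest scope)
The letters of `s@c` are NOT those of `s`: along a PERM2-0 centre the shade may jump at special `K`-points
(PR-1's `…MohAlongSpecialPoint.not_shadeConstantAlongMode1hCentre`), so no bound in terms of `d = shade(s)` alone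
is claimed at moving points; that is brick PR-1's subject (`MohAlong.shade_le_add_one_of_edge` under condition (2)
and constancy). [OURS · counted 0 · AI work weaker than expert review] NOTHING here proves resolution of
singularities in dimension ≥ 4 / characteristic `p`: laws of the letter `d` of OUR candidate frame (MODE 1h
coordinate game); census value (every `Edge` of a Hironaka-permissible coordinate centre now carries a PERM2-0
bound). bears_on: LADDER-RESOLUTION:D157-DOOR2 (res-dim4-pi · PR-2 × PR-1).
Supports stmt-ResolutionOfSingularities-16155 (helper).
-/

noncomputable section

set_option linter.dupNamespace false -- mandated namespace of this single-conjunct summit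
open MvPolynomial Finset
open scoped BigOperators

namespace Summit.ResolutionOfSingularities.ResolutionOfSingularities.Theorems.PIDim4
namespace Perm2Bound
open Literature.AlgebraicGeometry.Resolution
open Literature.AlgebraicGeometry.Resolution.CentreBlowup
open Literature.AlgebraicGeometry.Resolution.Hauser2010

section Along
variable {σ : Type*} {K : Type*} [Field K] [Fintype σ] [DecidableEq σ] [DecidableEq K]
variable (p : ℕ) [hp : Fact p.Prime] [CharP K p]

/-- **The moved state satisfies the hypotheses of parts 3–8** (PR-1's transport, packaged): for `c` supported
off `S`, a clean non-zero `F` with `x^r ∣ F` and condition (1) gives a moved state `s@c` which is clean, non-zero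
(of some finite order `o_c`), divisible by `x^{r_c}` monomialwise, satisfies condition (1), and has
`ordAlong S F_c = degIn S r_c + g_c` for some `g_c`. [folklore] -/
theorem moved_hypotheses (q : ℕ) {S : Finset σ} (c : σ → K) (hc : ∀ i ∈ S, c i = 0) (s : CState σ K)
    (hclean : deletePthPowers q s.F = s.F) (hF : s.F ≠ 0) (hr : ∀ d ∈ s.F.support, s.r ≤ d)
    (hq : ∀ d ∈ s.F.support, q ≤ degIn S d) :
    deletePthPowers q (deletePthPowers q (PointBlowup.translate c s.F)) =
        deletePthPowers q (PointBlowup.translate c s.F) ∧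
    (∃ oc : ℕ, ordZero (deletePthPowers q (PointBlowup.translate c s.F)) = oc) ∧
    (∀ d ∈ (deletePthPowers q (PointBlowup.translate c s.F)).support, s.r.filter (fun i => c i = 0) ≤ d) ∧
    (∀ d ∈ (deletePthPowers q (PointBlowup.translate c s.F)).support, q ≤ degIn S d) ∧
    ∃ gc : ℕ, ordAlong S (deletePthPowers q (PointBlowup.translate c s.F)) =
      ((degIn S (s.r.filter (fun i => c i = 0)) + gc : ℕ) : ℕ∞) := by
  have hFc : deletePthPowers q (PointBlowup.translate c s.F) ≠ 0 :=
    MohAlong.clean_translate_ne_zero q c hclean hF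
  have hrc : ∀ d ∈ (deletePthPowers q (PointBlowup.translate c s.F)).support,
      s.r.filter (fun i => c i = 0) ≤ d :=
    fun d hd => MohAlong.filter_le_of_mem_support_clean_translate q c hr hd
  refine ⟨PointBlowup.deletePthPowers_deletePthPowers q _, exists_ordZero_eq_natCast hFc, hrc,
    fun d hd => MohAlong.le_degIn_of_mem_support_clean_translate q c hc hq hd, ?_⟩
  obtain ⟨d₁, hd₁, hd₁eq⟩ := exists_mem_support_ordAlong_eq S hFc
  have hle : degIn S (s.r.filter (fun i => c i = 0)) ≤ degIn S d₁ := degIn_le_degIn_of_le S (hrc d₁ hd₁)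
  exact ⟨degIn S d₁ - degIn S (s.r.filter (fun i => c i = 0)), by rw [hd₁eq, Nat.add_sub_cancel' hle]⟩

/-! ### §1 Part 3 transported: `d′ + g_c ≤ 2 d_c + p^{e−1}` at every chart point -/

/-- **`d′ + ordAlong S F_c ≤ 2 d_c + degIn S r_c + p^{e−1}` AT EVERY CHART POINT** (`q = p^e`, `e ≥ 1`; clean
non-zero `F`, `x^r ∣ F`, condition (1) for `S ∋ j`; chart point `b = b′ + c`, `b′` supported on `S ∖ j`, `c`
supported off `S`; `(F_c, r_c) = (clean F(x + c), r|_{c=0})`, `d_c` its shade): PR-1's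
`MohAlong.step_add_eq_step_translate_clean` followed by part 3's `shade_step_add_le_two_mul_add_pow` for the
moved state. [cite: Moh1987, Stability Theorem (one permissible blow-up), §1 Propositions 1–2]
[cite: HauserPerlega2019PRIMS, §3 Theorem (9)] -/
theorem shade_step_add_le_two_mul_add_pow_along {e : ℕ} (he : 1 ≤ e) {S : Finset σ} {j : σ} (hj : j ∈ S)
    (b' c : σ → K) (hb'j : b' j = 0) (hb'N : ∀ i, i ∉ S → b' i = 0) (hc : ∀ i ∈ S, c i = 0)
    (s : CState σ K) (hclean : deletePthPowers (p ^ e) s.F = s.F) (hF : s.F ≠ 0)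
    (hr : ∀ d ∈ s.F.support, s.r ≤ d) (hq : ∀ d ∈ s.F.support, p ^ e ≤ degIn S d) :
    (step (p ^ e) S j (b' + c) s).shade +
        ordAlong S (deletePthPowers (p ^ e) (PointBlowup.translate c s.F)) ≤
      2 * (⟨deletePthPowers (p ^ e) (PointBlowup.translate c s.F), s.r.filter (fun i => c i = 0),
            s.exc.filter (fun i => c i = 0)⟩ : CState σ K).shade +
        (degIn S (s.r.filter (fun i => c i = 0)) : ℕ∞) + ((p ^ (e - 1) : ℕ) : ℕ∞) := by
  rw [MohAlong.step_add_eq_step_translate_clean p e hj b' c hb'N hc s hclean]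
  obtain ⟨hcleanc, ⟨oc, hoc⟩, hrc, hqc, gc, hgc⟩ := moved_hypotheses (p ^ e) c hc s hclean hF hr hq
  have h := shade_step_add_le_two_mul_add_pow p he hj b' hb'j hb'N
    ⟨deletePthPowers (p ^ e) (PointBlowup.translate c s.F), s.r.filter (fun i => c i = 0),
      s.exc.filter (fun i => c i = 0)⟩ hcleanc hoc hrc hqc hgc
  rw [hgc, Nat.cast_add]
  calc (step (p ^ e) S j b' ⟨deletePthPowers (p ^ e) (PointBlowup.translate c s.F),
          s.r.filter (fun i => c i = 0), s.exc.filter (fun i => c i = 0)⟩).shade +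
        ((degIn S (s.r.filter (fun i => c i = 0)) : ℕ∞) + (gc : ℕ∞))
      = ((step (p ^ e) S j b' ⟨deletePthPowers (p ^ e) (PointBlowup.translate c s.F),
          s.r.filter (fun i => c i = 0), s.exc.filter (fun i => c i = 0)⟩).shade + (gc : ℕ∞)) +
          (degIn S (s.r.filter (fun i => c i = 0)) : ℕ∞) := by ring
    _ ≤ (2 * (⟨deletePthPowers (p ^ e) (PointBlowup.translate c s.F), s.r.filter (fun i => c i = 0),
            s.exc.filter (fun i => c i = 0)⟩ : CState σ K).shade + ((p ^ (e - 1) : ℕ) : ℕ∞)) +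
          (degIn S (s.r.filter (fun i => c i = 0)) : ℕ∞) := add_le_add h le_rfl
    _ = _ := by ring

/-! ### §2 Parts 6a and 7 transported (class of record `q = p`) -/

set_option maxHeartbeats 400000 in
/-- **Maximal excess at a chart point ⟺ TIGHT ∧ KANGAROO, read on the moved state** (`q = p`): with
`b = b′ + c` as in §1 and `ordAlong S F_c = degIn S r_c + g_c`,
`d′ + g_c = 2 d_c + 1 ⟺` the edge `(s@c, S, j, b′)` is tight (part 6a) `∧ PointBlowup.ShadeIncreases p j b′ (s@c)`.
[cite: Moh1987, Stability Theorem, §1 (p. 972)] [cite: HauserPerlega2019PRIMS, §3 Theorem (9) and Comment (d)] -/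
theorem shade_step_add_eq_two_mul_add_one_iff_along {S : Finset σ} {j : σ} (hj : j ∈ S) (b' c : σ → K)
    (hb'j : b' j = 0) (hb'N : ∀ i, i ∉ S → b' i = 0) (hc : ∀ i ∈ S, c i = 0) (s : CState σ K)
    (hclean : deletePthPowers p s.F = s.F) (hr : ∀ d ∈ s.F.support, s.r ≤ d)
    (hq : ∀ d ∈ s.F.support, p ≤ degIn S d) {oc : ℕ}
    (hoc : ordZero (deletePthPowers p (PointBlowup.translate c s.F)) = oc) {gc : ℕ}
    (hgc : ordAlong S (deletePthPowers p (PointBlowup.translate c s.F)) =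
      ((degIn S (s.r.filter (fun i => c i = 0)) + gc : ℕ) : ℕ∞)) :
    (step p S j (b' + c) s).shade + (gc : ℕ∞) =
        2 * (⟨deletePthPowers p (PointBlowup.translate c s.F), s.r.filter (fun i => c i = 0),
              s.exc.filter (fun i => c i = 0)⟩ : CState σ K).shade + 1 ↔
      (∃ E ∈ (step p S j (b' + c) s).F.support,
          (E.degree : ℕ∞) = ordZero (step p S j (b' + c) s).F ∧
            ∀ i, i ∉ S → E i = (s.r.filter (fun i => c i = 0)) i) ∧
        PointBlowup.ShadeIncreases p j b'
          (⟨deletePthPowers p (PointBlowup.translate c s.F), s.r.filter (fun i => c i = 0),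
            s.exc.filter (fun i => c i = 0)⟩ : CState σ K).toState := by
  have hstep := MohAlong.step_add_eq_step_translate_clean p 1 hj b' c hb'N hc s
    (by rw [pow_one]; exact hclean)
  rw [pow_one] at hstep
  rw [hstep]
  have hrc : ∀ d ∈ (deletePthPowers p (PointBlowup.translate c s.F)).support,
      s.r.filter (fun i => c i = 0) ≤ d :=
    fun d hd => MohAlong.filter_le_of_mem_support_clean_translate p c hr hd
  have hqc : ∀ d ∈ (deletePthPowers p (PointBlowup.translate c s.F)).support, p ≤ degIn S d :=
    fun d hd => MohAlong.le_degIn_of_mem_support_clean_translate p c hc hq hd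
  exact shade_step_add_eq_two_mul_add_one_iff p hj b' hb'j hb'N _
    (PointBlowup.deletePthPowers_deletePthPowers p _) hoc hrc hqc hgc

set_option maxHeartbeats 400000 in
/-- **No second excess after a maximal excess at a chart point** (`q = p`): if `d′ + g_c = 2 d_c + 1` at
`b = b′ + c`, then for every condition-(1) centre `S′ ∋ j′` of the NEW state `s′` and every point `b″` over the
origin of `S′`: `d″ + g′ ≤ 2 d′` — part 7 for the moved state, since `s′ = step p S j b′ (s@c)` verbatim.
[cite: Moh1987, §1 (p. 972, cases (1)–(2))] [cite: Hauser2010, §G] -/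
theorem shade_step_step_add_le_two_mul_along {S : Finset σ} {j : σ} (hj : j ∈ S) (b' c : σ → K)
    (hb'j : b' j = 0) (hb'N : ∀ i, i ∉ S → b' i = 0) (hc : ∀ i ∈ S, c i = 0) (s : CState σ K)
    (hclean : deletePthPowers p s.F = s.F) (hr : ∀ d ∈ s.F.support, s.r ≤ d)
    (hq : ∀ d ∈ s.F.support, p ≤ degIn S d) {oc : ℕ}
    (hoc : ordZero (deletePthPowers p (PointBlowup.translate c s.F)) = oc) {gc : ℕ}
    (hgc : ordAlong S (deletePthPowers p (PointBlowup.translate c s.F)) =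
      ((degIn S (s.r.filter (fun i => c i = 0)) + gc : ℕ) : ℕ∞))
    (heq : (step p S j (b' + c) s).shade + (gc : ℕ∞) =
      2 * (⟨deletePthPowers p (PointBlowup.translate c s.F), s.r.filter (fun i => c i = 0),
            s.exc.filter (fun i => c i = 0)⟩ : CState σ K).shade + 1)
    {S' : Finset σ} {j' : σ} (hj' : j' ∈ S') (b'' : σ → K) (hbj'' : b'' j' = 0)
    (hbN'' : ∀ i, i ∉ S' → b'' i = 0)
    (hq' : ∀ d ∈ (step p S j (b' + c) s).F.support, p ≤ degIn S' d) {g' : ℕ}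
    (hg' : ordAlong S' (step p S j (b' + c) s).F =
      ((degIn S' (step p S j (b' + c) s).r + g' : ℕ) : ℕ∞)) :
    (step p S' j' b'' (step p S j (b' + c) s)).shade + (g' : ℕ∞) ≤ 2 * (step p S j (b' + c) s).shade := by
  have hstep := MohAlong.step_add_eq_step_translate_clean p 1 hj b' c hb'N hc s
    (by rw [pow_one]; exact hclean)
  rw [pow_one] at hstep
  rw [hstep] at heq hq' hg' ⊢
  have hrc : ∀ d ∈ (deletePthPowers p (PointBlowup.translate c s.F)).support,
      s.r.filter (fun i => c i = 0) ≤ d :=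
    fun d hd => MohAlong.filter_le_of_mem_support_clean_translate p c hr hd
  have hqc : ∀ d ∈ (deletePthPowers p (PointBlowup.translate c s.F)).support, p ≤ degIn S d :=
    fun d hd => MohAlong.le_degIn_of_mem_support_clean_translate p c hc hq hd
  exact shade_step_step_add_le_two_mul p hj b' hb'j hb'N _ (PointBlowup.deletePthPowers_deletePthPowers p _)
    hoc hrc hqc hgc heq hj' b'' hbj'' hbN'' hq' hg'

end Along
end Perm2Bound

/-! ### §3 Class (4,1): an arbitrary chart point `b`, split by `S.piecewise` -/

section Cell
open Literature.AlgebraicGeometry.Resolution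
open Literature.AlgebraicGeometry.Resolution.CentreBlowup
open Literature.AlgebraicGeometry.Resolution.Hauser2010
variable {K : Type} [Field K] [DecidableEq K] (p : ℕ) [Fact p.Prime] [CharP K p]

/-- **The translated bound at EVERY point of EVERY chart, class (4,1), `q = p^e`**: for a clean presented state
`s` (`F ≠ 0`, `x^r ∣ F`), a Hironaka-permissible coordinate centre `S ∋ j` and ANY point `b` of the `x_j`-chart
(`b_j = 0`), with `c = S.piecewise 0 b` the part of `b` along the centre and `(F_c, r_c)` the moved state:
`d′ + ordAlong S F_c ≤ 2 d_c + degIn S r_c + p^{e−1}`. [OURS · about the candidate frame]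
[cite: Moh1987, Stability Theorem (one permissible blow-up), §1] [cite: HauserPerlega2019PRIMS, §3 Theorem (9)] -/
theorem shade_add_ordAlong_le_add_pow_of_edge_point {e : ℕ} (he : 1 ≤ e) {S : Finset (Fin 4)} {j : Fin 4}
    (hj : j ∈ S) (b : Fin 4 → K) (hbj : b j = 0) (s : State K)
    (hclean : deletePthPowers (p ^ e) s.F = s.F) (hF : s.F ≠ 0) (hr : ∀ d ∈ s.F.support, s.r ≤ d)
    (hS : IsPermissibleCentre (p ^ e) S s.F) :
    (CentreBlowup.step (p ^ e) S j b s).shade +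
        ordAlong S (deletePthPowers (p ^ e) (PointBlowup.translate (S.piecewise (0 : Fin 4 → K) b) s.F)) ≤
      2 * (⟨deletePthPowers (p ^ e) (PointBlowup.translate (S.piecewise (0 : Fin 4 → K) b) s.F),
            s.r.filter (fun i => S.piecewise (0 : Fin 4 → K) b i = 0),
            s.exc.filter (fun i => S.piecewise (0 : Fin 4 → K) b i = 0)⟩ : State K).shade +
        (degIn S (s.r.filter (fun i => S.piecewise (0 : Fin 4 → K) b i = 0)) : ℕ∞) +
        ((p ^ (e - 1) : ℕ) : ℕ∞) := by
  have h := Perm2Bound.shade_step_add_le_two_mul_add_pow_along p he hj (S.piecewise b (0 : Fin 4 → K))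
    (S.piecewise (0 : Fin 4 → K) b) (by rw [Finset.piecewise, if_pos hj, hbj])
    (fun i hi => by rw [Finset.piecewise, if_neg hi, Pi.zero_apply])
    (fun i hi => by rw [Finset.piecewise, if_pos hi, Pi.zero_apply]) s hclean hF hr
    (forall_le_degIn_of_isPermissibleCentre hS)
  rwa [MohAlong.piecewise_add_piecewise] at h

end Cell

end Summit.ResolutionOfSingularities.ResolutionOfSingularities.Theorems.PIDim4

end
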